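import Mathlib

/-!
# Laplace-transform layer cake and Gamma tails (part 1 of the uniform Tauberian sandwich serving support item `TwistEaterVolume.TauberUniform` ⟨stmt-QuantumFields-24321⟩; part 2 = `TwistEaterVolumeTauberUniform.lean`)

Free-hands work of the LEAD seat `ym-line-sfw-p2` (gen 74) for planner `ym-idea-4`'s LINE g15-A
(route `TwistEaterVolume`, DRAFT by design) and the «tauber» skeleton on crux ⟨24204⟩
`VirialFluxGap.SharpTwistedLaplace`: the elementary, dimension-explicit ABELIAN/TAUBERIAN transfer

  power-law small-ball volumes `μ{F ≤ t} = v·t^N·(1 ± κt)` on `(0,t₀]` for a probability measure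
  ⟹ `|log ∫ e^{−βF} dμ − (log v + log N! − N·log β)| ≤ (4κ(N+1)+4)/β`

as soon as `β ≥ 2`, `β ≥ 2(κ(N+1)+1)` and `64(N+2)²(1 + |log v| + |log t₀| + log β) ≤ β·t₀`.

Proof: layer cake `∫ e^{−βF} dμ = ∫_{s>0} βe^{−βs}·μ{F ≤ s} ds` (Mathlib's
`lintegral_comp_eq_lintegral_meas_lt_mul` with `g t = βe^{−βt}` and the complement rule of a
probability space); the main term is `v·N!/β^N·(1 ± κ(N+1)/β)` (Gamma integrals); the truncation
tail `∫_{s>t₀} s^N e^{−βs} ds ≤ (2/β)·t₀^N·e^{−βt₀/2}` (from `s/t₀ ≤ e^{s/t₀−1}` and `2N ≤ βt₀`) and the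
far tail `≤ e^{−βt₀}` are both `≤ (v·N!/β^N)/β` on the stated window; finally `|log(1 ± δ)| ≤ 2δ` for
`δ = (κ(N+1)+1)/β ≤ 1/2`.  The stated constant `(4κ(N+1)+4)/β` has a factor-two margin.

HONEST LABEL: a support item (pure measure theory / real analysis) of a DRAFT-by-design sub-route;
no crux, rung or summit statement is proved here; the Yang–Mills mass gap is NOT proved by this.
-/

noncomputable section

namespace Summit.QuantumFields.YangMills.Theorems.TwistEaterVolume.Tauber

open MeasureTheory Set Filter Real
open scoped Nat Topology

/-! ## One-dimensional integrals -/

/-- `∫₀ˣ β e^{−βt} dt = 1 − e^{−βx}`. -/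
theorem intervalIntegral_mul_exp_neg_mul (β x : ℝ) :
    ∫ t in (0:ℝ)..x, β * rexp (-(β * t)) = 1 - rexp (-(β * x)) := by
  have h : ∀ t ∈ Set.uIcc 0 x,
      HasDerivAt (fun t => -rexp (-(β * t))) (β * rexp (-(β * t))) t := by
    intro t _
    have h1 : HasDerivAt (fun s => -(β * s)) (-β) t := by
      simpa using ((hasDerivAt_id t).const_mul β).fun_neg
    exact h1.exp.fun_neg.congr_deriv (by ring)
  rw [intervalIntegral.integral_eq_sub_of_hasDerivAt h
    ((by fun_prop : Continuous fun t => β * rexp (-(β * t))).intervalIntegrable _ _)]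
  simp only [mul_zero, neg_zero, Real.exp_zero]
  ring

/-- `∫_{s>c} β e^{−βs} ds = e^{−βc}` for `β > 0`. -/
theorem integral_mul_exp_neg_mul_Ioi {β : ℝ} (hβ : 0 < β) (c : ℝ) :
    ∫ s in Ioi c, β * rexp (-(β * s)) = rexp (-(β * c)) := by
  have h := integral_exp_mul_Ioi (a := -β) (by linarith) c
  simp_rw [neg_mul] at h
  rw [integral_const_mul, h]
  field_simp

/-- Integrability of `β e^{−βs}` on `(c, ∞)`. -/
theorem integrableOn_mul_exp_neg_mul_Ioi {β : ℝ} (hβ : 0 < β) (c : ℝ) :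
    IntegrableOn (fun s => β * rexp (-(β * s))) (Ioi c) := by
  have h := (exp_neg_integrableOn_Ioi c hβ).const_mul β
  simp_rw [neg_mul] at h
  exact h

/-- `∫_{s>0} s^k e^{−βs} ds = k!/β^{k+1}`. -/
theorem integral_pow_mul_exp_neg_mul_Ioi (k : ℕ) {β : ℝ} (hβ : 0 < β) :
    ∫ s in Ioi (0:ℝ), s ^ k * rexp (-(β * s)) = k ! / β ^ (k + 1) := by
  have hk : (0 : ℝ) < ↑k + 1 := by positivity
  have key := integral_rpow_mul_exp_neg_mul_Ioi hk hβ
  calc ∫ s in Ioi (0:ℝ), s ^ k * rexp (-(β * s))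
      = ∫ s in Ioi (0:ℝ), s ^ ((↑k + 1 : ℝ) - 1) * rexp (-(β * s)) := by
        apply setIntegral_congr_fun measurableSet_Ioi
        intro s _
        simp [add_sub_cancel_right, rpow_natCast]
    _ = k ! / β ^ (k + 1) := by
        simp_rw [key, Gamma_nat_eq_factorial, div_eq_mul_inv, one_mul, mul_comm, inv_rpow hβ.le,
          ← rpow_natCast]
        norm_cast

/-- Integrability of `s^k e^{−βs}` on `(0, ∞)`. -/
theorem integrableOn_pow_mul_exp_neg_mul_Ioi (k : ℕ) {β : ℝ} (hβ : 0 < β) :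
    IntegrableOn (fun s : ℝ => s ^ k * rexp (-(β * s))) (Ioi 0) :=
  .of_integral_ne_zero (by rw [integral_pow_mul_exp_neg_mul_Ioi k hβ]; positivity)

/-! ## Layer cake for the Laplace transform of a nonnegative random variable -/

section LayerCake

variable {Ω : Type*} [MeasurableSpace Ω] {μ : Measure Ω} [IsProbabilityMeasure μ]

/-- The sublevel-volume function `s ↦ μ{F ≤ s}` is measurable (it is monotone). -/
theorem measurable_sublevel (F : Ω → ℝ) : Measurable fun s : ℝ => μ.real {ω | F ω ≤ s} :=
  Monotone.measurable fun _ _ hst => measureReal_mono fun _ hω => le_trans hω hst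

/-- `e^{−βF}` is integrable on a probability space when `F ≥ 0` is measurable. -/
theorem integrable_exp_neg_mul (F : Ω → ℝ) (hF : Measurable F) (hF0 : ∀ ω, 0 ≤ F ω) {β : ℝ}
    (hβ : 0 < β) : Integrable (fun ω => rexp (-(β * F ω))) μ := by
  refine (integrable_const (1:ℝ)).mono' (by fun_prop) (Eventually.of_forall fun ω => ?_)
  rw [Real.norm_eq_abs, abs_of_pos (exp_pos _), exp_le_one_iff, neg_nonpos]
  exact mul_nonneg hβ.le (hF0 ω)

/-- `s ↦ βe^{−βs}·μ{F ≤ s}` is integrable on `(0, ∞)`. -/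
theorem integrableOn_mul_exp_neg_mul_mul_sublevel (F : Ω → ℝ) {β : ℝ} (hβ : 0 < β) :
    IntegrableOn (fun s : ℝ => β * rexp (-(β * s)) * μ.real {ω | F ω ≤ s}) (Ioi 0) := by
  refine Integrable.mono (integrableOn_mul_exp_neg_mul_Ioi hβ 0)
    ((by fun_prop : Measurable fun s : ℝ => β * rexp (-(β * s))).mul
      (measurable_sublevel (μ := μ) F)).aestronglyMeasurable (Eventually.of_forall fun s => ?_)
  rw [norm_mul, Real.norm_eq_abs (μ.real _), abs_of_nonneg measureReal_nonneg]
  exact mul_le_of_le_one_right (norm_nonneg _) measureReal_le_one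

/-- LAYER CAKE for the Laplace transform: `∫ e^{−βF} dμ = ∫_{s>0} βe^{−βs}·μ{F ≤ s} ds` for a
measurable `F ≥ 0` on a probability space and `β > 0`. -/
theorem integral_exp_neg_mul_eq_integral_sublevel (F : Ω → ℝ) (hF : Measurable F)
    (hF0 : ∀ ω, 0 ≤ F ω) {β : ℝ} (hβ : 0 < β) :
    ∫ ω, rexp (-(β * F ω)) ∂μ = ∫ s in Ioi (0:ℝ), β * rexp (-(β * s)) * μ.real {ω | F ω ≤ s} := by
  set G : ℝ → ℝ := fun s => μ.real {ω | F ω ≤ s} with hG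
  have hG1 : ∀ s, G s ≤ 1 := fun s => measureReal_le_one
  have hint := integrable_exp_neg_mul (μ := μ) F hF hF0 hβ
  have hintG := integrableOn_mul_exp_neg_mul_mul_sublevel (μ := μ) F hβ
  have hintg := integrableOn_mul_exp_neg_mul_Ioi hβ 0
  -- Mathlib's layer-cake formula with `g t = β e^{−βt}`
  have key := lintegral_comp_eq_lintegral_meas_lt_mul μ (f := F)
    (g := fun t => β * rexp (-(β * t))) (Eventually.of_forall hF0) hF.aemeasurable
    (fun t _ => (by fun_prop : Continuous fun t => β * rexp (-(β * t))).intervalIntegrable _ _)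
    (Eventually.of_forall fun t => by positivity)
  -- left-hand side of `key`
  have hL : ∫⁻ ω, ENNReal.ofReal (∫ t in (0:ℝ)..F ω, β * rexp (-(β * t))) ∂μ
      = ENNReal.ofReal (∫ ω, (1 - rexp (-(β * F ω))) ∂μ) := by
    simp_rw [intervalIntegral_mul_exp_neg_mul]
    refine (ofReal_integral_eq_lintegral_ofReal ((integrable_const _).sub hint)
      (Eventually.of_forall fun ω => ?_)).symm
    have : rexp (-(β * F ω)) ≤ 1 := by
      rw [exp_le_one_iff, neg_nonpos]; exact mul_nonneg hβ.le (hF0 ω)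
    simpa using this
  -- right-hand side of `key`
  have hset : ∀ t, μ {a | t < F a} = ENNReal.ofReal (1 - G t) := by
    intro t
    have hms : MeasurableSet {ω | F ω ≤ t} := hF measurableSet_Iic
    have h1 : {a | t < F a} = {ω | F ω ≤ t}ᶜ := by ext ω; simp [not_le]
    rw [h1, ← ofReal_measureReal, hG]
    congr 1
    linarith [probReal_add_probReal_compl (μ := μ) hms]
  have hR : ∫⁻ t in Ioi 0, μ {a | t < F a} * ENNReal.ofReal (β * rexp (-(β * t)))
      = ENNReal.ofReal (∫ t in Ioi 0, (β * rexp (-(β * t)) - β * rexp (-(β * t)) * G t)) := by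
    have h2 : ∀ t, μ {a | t < F a} * ENNReal.ofReal (β * rexp (-(β * t))) =
        ENNReal.ofReal (β * rexp (-(β * t)) - β * rexp (-(β * t)) * G t) := by
      intro t
      rw [hset, ← ENNReal.ofReal_mul (sub_nonneg.2 (hG1 t))]
      congr 1; ring
    simp_rw [h2]
    refine (ofReal_integral_eq_lintegral_ofReal (hintg.sub hintG) ?_).symm
    refine Eventually.of_forall fun t => ?_
    have : β * rexp (-(β * t)) * G t ≤ β * rexp (-(β * t)) * 1 :=
      mul_le_mul_of_nonneg_left (hG1 t) (by positivity)
    simpa using this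
  rw [hL, hR] at key
  have hnn1 : 0 ≤ ∫ ω, (1 - rexp (-(β * F ω))) ∂μ :=
    integral_nonneg fun ω => by
      have : rexp (-(β * F ω)) ≤ 1 := by
        rw [exp_le_one_iff, neg_nonpos]; exact mul_nonneg hβ.le (hF0 ω)
      simpa using this
  have hnn2 : 0 ≤ ∫ t in Ioi 0, (β * rexp (-(β * t)) - β * rexp (-(β * t)) * G t) :=
    setIntegral_nonneg measurableSet_Ioi fun t _ => by
      have : β * rexp (-(β * t)) * G t ≤ β * rexp (-(β * t)) * 1 :=
        mul_le_mul_of_nonneg_left (hG1 t) (by positivity)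
      simpa using this
  have key' := (ENNReal.ofReal_eq_ofReal_iff hnn1 hnn2).1 key
  rw [integral_sub (integrable_const _) hint, integral_sub hintg hintG,
    integral_mul_exp_neg_mul_Ioi hβ 0] at key'
  simp only [integral_const, probReal_univ, smul_eq_mul, one_mul, mul_zero, neg_zero,
    Real.exp_zero] at key'
  linarith

end LayerCake

/-! ## The truncation tail -/

/-- Truncation tail of the Gamma integral: for `0 < t₀` and `2N ≤ βt₀`,
`∫_{s>t₀} s^N e^{−βs} ds ≤ (2/β)·t₀^N·e^{−βt₀/2}` (from `s/t₀ ≤ e^{s/t₀−1}`; no incomplete-Gamma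
asymptotics needed). -/
theorem integral_Ioi_pow_mul_exp_neg_mul_le (N : ℕ) {β t₀ : ℝ} (hβ : 0 < β) (ht₀ : 0 < t₀)
    (hN : 2 * (N : ℝ) ≤ β * t₀) :
    ∫ s in Ioi t₀, s ^ N * rexp (-(β * s)) ≤ 2 / β * t₀ ^ N * rexp (-(β * t₀ / 2)) := by
  have hpt : ∀ s ∈ Ioi t₀, s ^ N * rexp (-(β * s)) ≤ t₀ ^ N * rexp (-(β / 2 * s)) := by
    intro s hs
    have hs0 : 0 < s := ht₀.trans hs
    have h1 : s / t₀ ≤ rexp (s / t₀ - 1) := by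
      have := add_one_le_exp (s / t₀ - 1); linarith
    have h2 : s ^ N ≤ t₀ ^ N * rexp (N * (s / t₀ - 1)) := by
      have h3 : (s / t₀) ^ N ≤ rexp (s / t₀ - 1) ^ N := pow_le_pow_left₀ (by positivity) h1 N
      rw [← Real.exp_nat_mul, div_pow, div_le_iff₀ (by positivity)] at h3
      linarith [h3]
    have h4 : (N : ℝ) * (s / t₀ - 1) + -(β * s) ≤ -(β / 2 * s) := by
      have h5 : (N : ℝ) * s ≤ β / 2 * s * t₀ := by nlinarith [hN, hs0.le]
      have h6 : (N : ℝ) * (s / t₀) ≤ β / 2 * s := by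
        rw [mul_div_assoc', div_le_iff₀ ht₀]; exact h5
      nlinarith [h6, (Nat.cast_nonneg N : (0:ℝ) ≤ N)]
    calc s ^ N * rexp (-(β * s)) ≤ t₀ ^ N * rexp (N * (s / t₀ - 1)) * rexp (-(β * s)) :=
          mul_le_mul_of_nonneg_right h2 (exp_nonneg _)
      _ = t₀ ^ N * rexp (N * (s / t₀ - 1) + -(β * s)) := by rw [mul_assoc, ← Real.exp_add]
      _ ≤ t₀ ^ N * rexp (-(β / 2 * s)) :=
          mul_le_mul_of_nonneg_left (exp_le_exp.2 h4) (by positivity)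
  have hβ2 : 0 < β / 2 := by positivity
  have hintR : IntegrableOn (fun s => t₀ ^ N * rexp (-(β / 2 * s))) (Ioi t₀) := by
    have := (exp_neg_integrableOn_Ioi t₀ hβ2).const_mul (t₀ ^ N)
    simp_rw [neg_mul] at this
    exact this
  have hintL : IntegrableOn (fun s : ℝ => s ^ N * rexp (-(β * s))) (Ioi t₀) :=
    (integrableOn_pow_mul_exp_neg_mul_Ioi N hβ).mono_set (Ioi_subset_Ioi ht₀.le)
  calc ∫ s in Ioi t₀, s ^ N * rexp (-(β * s)) ≤ ∫ s in Ioi t₀, t₀ ^ N * rexp (-(β / 2 * s)) :=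
        setIntegral_mono_on hintL hintR measurableSet_Ioi hpt
    _ = t₀ ^ N * (2 / β * rexp (-(β * t₀ / 2))) := by
        rw [integral_const_mul]
        congr 1
        have h := integral_exp_mul_Ioi (a := -(β / 2)) (by linarith) t₀
        simp_rw [neg_mul] at h
        rw [h]
        field_simp
    _ = 2 / β * t₀ ^ N * rexp (-(β * t₀ / 2)) := by ring

end Summit.QuantumFields.YangMills.Theorems.TwistEaterVolume.Tauber

end
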